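import Mathlib
import Literature.Analysis.Quadrature.DigitalShift

/-!
# `b`-adic Walsh functions and digital nets over `ℤ_b`

The Walsh-function calculus behind digital nets ([Dick–Pillichshammer 2010, App. A, §4.4, §15.1];
[Lemieux 2009, §5.6, §6.2]), built on the digit space `ℕ → Fin b` with its product law
`digitSeqMeasure b` of `Literature.Analysis.Quadrature.DigitalShift`:

* `natDigit b k i` — the base-`b` digits `κ_i` of a wavenumber `k ∈ ℕ`;
  `walshPhase`, `walshD b k ξ = ω_b^{κ₀ ξ₁ + κ₁ ξ₂ + ⋯}` — the `k`-th `b`-adic Walsh function read off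
  a digit sequence, `walsh b k x = walshD b k (Real.digits x b)` — the Walsh function `ₖwal_b` on
  `[0,1)` [DP2010, Def. A.1], `walshPi b k x = ∏_j wal_{k_j}(x_j)` [DP2010, Def. A.3];
  `|wal_k| = 1`, `wal_0 = 1`, `conj wal_k = 1/wal_k` [DP2010, Prop. A.4].
* **Orthonormality** [DP2010, Prop. A.9, A.10]: `∫₀¹ wal_k conj(wal_l) = [k = l]` for `b ≥ 2`
  (`setIntegral_walsh_mul_conj_walsh`, via independence and uniformity of the digits of a uniform
  point, `map_digits_restrict_Ico`, and the character sums of `ℤ_b`), and on `[0,1)ˢ`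
  (`setIntegral_walshPi_mul_conj_walshPi`); Walsh coefficients `walshCoeff b f k = ∫ f conj(wal_k)`
  [DP2010, Rem. A.15] and their identification for absolutely convergent Walsh series
  (`walshCoeff_tsum_mul_walshPi`).
* **Digital nets over `ℤ_b`** [DP2010, Def. 4.47; Lemieux 2009, Def. 5.5]: generating matrices
  `C_j ∈ ℤ_b^{p × m}`, points `digitalNetPoint C h⃗` indexed by digit vectors `h⃗ ∈ ℤ_b^m`
  (`x_{h,j} = y₁/b + ⋯ + y_p/b^p`, `y = C_j h⃗`; `pointOfDigits_eq_sum`, `digits_pointOfDigits`);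
  the group structure `x_{h₁} ⊕ x_{h₂} = x_{h₁+h₂}` [DP2010, Lemma 4.72]
  (`digitalShiftPi_digitalNetPoint`); the dual net `dualNet C` [DP2010, Def. 4.76, Rem. 4.77;
  Lemieux 2009, eq. (5.27)]; the **character property**
  `Σ_h wal_k(x_h) = b^m 𝟙_D(k)` [DP2010, Lemma 4.75; Lemieux 2009, Lemma 5.18]
  (`sum_walshPi_digitalNetPoint`, `digitalNetRule_walshPi`).
* **Error of a digital net on a Walsh series** [DP2010, §15.1; Lemieux 2009, eq. (6.6)]:
  `b^{-m} Σ_h f(x_h) - ∫_{[0,1)ˢ} f = Σ_{k ∈ D ∖ {0}} f̂(k)` whenever `f` is represented by its Walsh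
  series at the nodes (`hasSum_digitalNetRule_sub_integral`, `digitalNetRule_sub_integral_eq_tsum`,
  `norm_digitalNetRule_sub_integral_le`), in particular for every absolutely convergent Walsh series
  (`hasSum_digitalNetRule_tsum_sub_integral`).

Generality. The sources take `b` prime (so that `ℤ_b` is a field, needed for the `t`-value theory,
not formalised here); the constructions and all results of this file hold over the ring `ℤ_b` for
every `b ≥ 2` (`[NeZero b]`, and `1 < b` where needed), with rectangular `p × m` generating matrices
(`p` = precision; [DP2010] takes `p = m`). Points are indexed by `h⃗ ∈ ℤ_b^m` rather than by
`0 ≤ h < b^m` (`card_index`: there are `b^m` of them).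

References: [DickPillichshammer2010] J. Dick, F. Pillichshammer, *Digital Nets and Sequences*,
CUP 2010 — Def. A.1, A.3, Prop. A.4, A.9, A.10, Def. A.14, Rem. A.15, Def. 4.47, Lemma 4.72, 4.75,
Def. 4.76, Rem. 4.77, §15.1. [Lemieux2009] C. Lemieux, *Monte Carlo and Quasi-Monte Carlo
Sampling*, Springer 2009 — Def. 5.5, eq. (5.27), Lemma 5.18, eq. (6.6).

AI-produced formalisation (H21 engines group, seat eng-quad-1, 2026-08-21); no facts, no axioms
beyond Mathlib's, no `sorry`.
-/

open MeasureTheory Set Complex Finset Matrix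
open scoped Real ENNReal ComplexConjugate

noncomputable section

namespace Literature.Analysis.Quadrature

variable (b : ℕ)

/-! ### Base-`b` digits of natural numbers -/

/-- The `i`-th base-`b` digit `κ_i = ⌊k / bⁱ⌋ mod b` of `k = κ₀ + κ₁ b + κ₂ b² + ⋯ ∈ ℕ`.
[cite: DickPillichshammer2010, Def. A.1] (notation `κ_i`) -/
def natDigit (k i : ℕ) : ℕ := k / b ^ i % b

/-- Digits are `< b`. [folklore] -/
private theorem natDigit_lt [NeZero b] (k i : ℕ) : natDigit b k i < b :=
  Nat.mod_lt _ (Nat.pos_of_neZero b)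

/-- All digits of `0` vanish. [folklore] -/
private theorem natDigit_zero (i : ℕ) : natDigit b 0 i = 0 := by simp [natDigit]

/-- The digits of `k < bⁱ` vanish from position `i` on. [folklore] -/
private theorem natDigit_eq_zero_of_lt {k i : ℕ} (h : k < b ^ i) : natDigit b k i = 0 := by
  simp [natDigit, Nat.div_eq_of_lt h]

/-- The digits of `k` vanish from position `k` on (`b ≥ 2`). [folklore] -/
private theorem natDigit_eq_zero_of_le (hb : 1 < b) {k i : ℕ} (h : k ≤ i) : natDigit b k i = 0 :=
  natDigit_eq_zero_of_lt b (h.trans_lt (Nat.lt_pow_self hb))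

/-- The digits `κ_0, …, κ_{r-1}` of `k < bʳ` are the coordinates of `k` under
`finFunctionFinEquiv : (Fin r → Fin b) ≃ Fin (b ^ r)`. [folklore] -/
private theorem finFunctionFinEquiv_symm_apply_eq_natDigit {r k : ℕ} (hk : k < b ^ r) (i : Fin r) :
    (finFunctionFinEquiv.symm ⟨k, hk⟩ i : ℕ) = natDigit b k i := by
  simp [natDigit]

/-- Two naturals `< bʳ` with the same first `r` digits are equal. [folklore] -/
private theorem eq_of_natDigit_eq {r k l : ℕ} (hk : k < b ^ r) (hl : l < b ^ r)
    (h : ∀ i < r, natDigit b k i = natDigit b l i) : k = l := by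
  have : finFunctionFinEquiv.symm ⟨k, hk⟩ = finFunctionFinEquiv.symm ⟨l, hl⟩ := by
    ext i
    rw [finFunctionFinEquiv_symm_apply_eq_natDigit, finFunctionFinEquiv_symm_apply_eq_natDigit,
      h i i.2]
  simpa using congrArg finFunctionFinEquiv this

variable [NeZero b]

/-- Two digits `κ, λ < b` that agree in `ℤ_b` are equal. [folklore] -/
private theorem natDigit_injOn_zmod {k l i j : ℕ} (h : (natDigit b k i : ZMod b) = natDigit b l j) :
    natDigit b k i = natDigit b l j := by
  rw [ZMod.natCast_eq_natCast_iff'] at h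
  rwa [Nat.mod_eq_of_lt (natDigit_lt b k i), Nat.mod_eq_of_lt (natDigit_lt b l j)] at h

/-! ### The `b`-adic Walsh system on the digit space and on `[0,1)` -/

/-- The Walsh phase `κ₀ ξ₁ + κ₁ ξ₂ + ⋯ ∈ ℤ_b` of the wavenumber `k = κ₀ + κ₁ b + ⋯` against a
digit sequence `ξ = (ξ₁, ξ₂, …)` (indexed from `0` in Lean: `ξ i` is the digit `ξ_{i+1}`); the sum
is finite since `κ_i = 0` for `i ≥ k`. [cite: DickPillichshammer2010, Def. A.1] -/
def walshPhase (k : ℕ) (ξ : ℕ → Fin b) : ZMod b :=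
  ∑ i ∈ range k, (natDigit b k i : ZMod b) * ((ξ i : ℕ) : ZMod b)

/-- The `k`-th `b`-adic Walsh function read off a digit sequence:
`wal_k(ξ) = ω_b^{κ₀ ξ₁ + κ₁ ξ₂ + ⋯}` with `ω_b = exp(2πi/b)`.
[cite: DickPillichshammer2010, Def. A.1] -/
def walshD (k : ℕ) (ξ : ℕ → Fin b) : ℂ :=
  ZMod.stdAddChar (walshPhase b k ξ)

/-- The `k`-th `b`-adic **Walsh function** `ₖwal_b : [0,1) → ℂ`,
`wal_k(x) = ω_b^{κ₀ ξ₁ + ⋯ + κ_{a-1} ξ_a}` for `x = ξ₁/b + ξ₂/b² + ⋯` (greedy expansion, so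
infinitely many `ξ_i ≠ b - 1`) and `k = κ₀ + κ₁ b + ⋯ + κ_{a-1} b^{a-1}`.
[cite: DickPillichshammer2010, Def. A.1] -/
def walsh (k : ℕ) (x : ℝ) : ℂ :=
  walshD b k (Real.digits x b)

/-- The multivariate Walsh function `wal_k(x) = ∏_j wal_{k_j}(x_j)` on `[0,1)^s`.
[cite: DickPillichshammer2010, Def. A.3] -/
def walshPi {ι : Type*} [Fintype ι] (k : ι → ℕ) (x : ι → ℝ) : ℂ :=
  ∏ j, walsh b (k j) (x j)

variable {b}

/-- The Walsh phase may be computed over any digit range `[0, N)` beyond which the digits of `k`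
vanish. [folklore] -/
private theorem walshPhase_eq_sum_of_natDigit_eq_zero {k N : ℕ}
    (hN : ∀ i, N ≤ i → natDigit b k i = 0) (ξ : ℕ → Fin b) :
    walshPhase b k ξ = ∑ i ∈ range N, (natDigit b k i : ZMod b) * ((ξ i : ℕ) : ZMod b) := by
  unfold walshPhase
  rcases Nat.lt_or_ge 1 b with hb | hb
  · have hk : ∀ i, k ≤ i → natDigit b k i = 0 := fun i hi => natDigit_eq_zero_of_le b hb hi
    have h1 : ∑ i ∈ range k, (natDigit b k i : ZMod b) * ((ξ i : ℕ) : ZMod b) =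
        ∑ i ∈ range (max k N), (natDigit b k i : ZMod b) * ((ξ i : ℕ) : ZMod b) :=
      sum_subset (range_subset_range.2 (le_max_left k N)) fun i _ hi => by
        rw [hk i (by simpa using hi), Nat.cast_zero, zero_mul]
    have h2 : ∑ i ∈ range N, (natDigit b k i : ZMod b) * ((ξ i : ℕ) : ZMod b) =
        ∑ i ∈ range (max k N), (natDigit b k i : ZMod b) * ((ξ i : ℕ) : ZMod b) :=
      sum_subset (range_subset_range.2 (le_max_right k N)) fun i _ hi => by
        rw [hN i (by simpa using hi), Nat.cast_zero, zero_mul]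
    rw [h1, h2]
  · have hb1 : b = 1 := le_antisymm hb (Nat.pos_of_neZero b)
    subst hb1
    exact Subsingleton.elim _ _

/-- The Walsh phase over a digit range `[0, N)` beyond which the digits `ξ_i` vanish. [folklore] -/
private theorem walshPhase_eq_sum_of_apply_eq_zero {k N : ℕ} {ξ : ℕ → Fin b}
    (hξ : ∀ i, N ≤ i → ξ i = 0) :
    walshPhase b k ξ = ∑ i ∈ range N, (natDigit b k i : ZMod b) * ((ξ i : ℕ) : ZMod b) := by
  rcases Nat.lt_or_ge 1 b with hb | hb
  · have hk : ∀ i, max k N ≤ i → natDigit b k i = 0 := fun i hi =>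
      natDigit_eq_zero_of_le b hb ((le_max_left k N).trans hi)
    have h2 : ∑ i ∈ range N, (natDigit b k i : ZMod b) * ((ξ i : ℕ) : ZMod b) =
        ∑ i ∈ range (max k N), (natDigit b k i : ZMod b) * ((ξ i : ℕ) : ZMod b) :=
      sum_subset (range_subset_range.2 (le_max_right k N)) fun i _ hi => by
        rw [hξ i (by simpa using hi), Fin.val_zero, Nat.cast_zero, mul_zero]
    rw [walshPhase_eq_sum_of_natDigit_eq_zero hk, h2]
  · have hb1 : b = 1 := le_antisymm hb (Nat.pos_of_neZero b)
    subst hb1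
    exact Subsingleton.elim _ _

/-- `wal_0 ≡ 1`. [cite: DickPillichshammer2010, Prop. A.9] (proof) -/
@[simp] theorem walshD_zero (ξ : ℕ → Fin b) : walshD b 0 ξ = 1 := by
  simp [walshD, walshPhase]

/-- `wal_0 ≡ 1`. [cite: DickPillichshammer2010, Prop. A.9] (proof) -/
@[simp] theorem walsh_zero (x : ℝ) : walsh b 0 x = 1 := walshD_zero _

/-- `wal_{(0,…,0)} ≡ 1`. [cite: DickPillichshammer2010, Prop. A.9] (with Def. A.3) -/
@[simp] theorem walshPi_zero {ι : Type*} [Fintype ι] (x : ι → ℝ) : walshPi b 0 x = 1 := by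
  simp [walshPi]

/-- Walsh functions take values in the `b`-th roots of unity (powers of `ω_b = e^{2πi/b}`); in
particular `|wal_k| = 1`. [cite: DickPillichshammer2010, Def. A.1] -/
theorem norm_walshD (k : ℕ) (ξ : ℕ → Fin b) : ‖walshD b k ξ‖ = 1 := by
  rw [walshD, ZMod.stdAddChar_apply, Circle.norm_coe]

/-- `|wal_k(x)| = 1`. [cite: DickPillichshammer2010, Def. A.1] -/
theorem norm_walsh (k : ℕ) (x : ℝ) : ‖walsh b k x‖ = 1 := norm_walshD _ _

/-- `|wal_k(x)| = 1` on `[0,1)ˢ`. [cite: DickPillichshammer2010, Def. A.3] -/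
theorem norm_walshPi {ι : Type*} [Fintype ι] (k : ι → ℕ) (x : ι → ℝ) : ‖walshPi b k x‖ = 1 := by
  simp [walshPi, norm_walsh]

/-- Complex conjugation inverts a Walsh function: `conj wal_k(ξ) = 1 / wal_k(ξ) = ω_b^{-(κ₀ ξ₁ + ⋯)}`.
[cite: DickPillichshammer2010, Prop. A.4] -/
theorem conj_walshD (k : ℕ) (ξ : ℕ → Fin b) :
    conj (walshD b k ξ) = ZMod.stdAddChar (-walshPhase b k ξ) := by
  rw [walshD, AddChar.map_neg_eq_inv, ← AddChar.inv_apply',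
    ← AddChar.starComp_apply (by rw [ZMod.ringChar_zmod_n]; exact Nat.pos_of_neZero b)]

/-- `wal_k` depends only on the first digits `ξ_1, …, ξ_k` (it is a step function, constant on
elementary intervals [cite: DickPillichshammer2010, Prop. A.2]), hence is measurable on the digit
space. -/
@[fun_prop] theorem measurable_walshD (k : ℕ) : Measurable (walshD b k) := by
  have : walshD b k = (fun g : ↥(range k) → Fin b =>
      ZMod.stdAddChar (∑ i : ↥(range k), (natDigit b k (i : ℕ) : ZMod b) * ((g i : ℕ) : ZMod b))) ∘
        Finset.restrict (range k) := by
    ext ξ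
    simp only [walshD, walshPhase, Function.comp_apply, Finset.restrict_def]
    rw [← sum_coe_sort]
  rw [this]
  exact (measurable_of_countable _).comp (Finset.measurable_restrict _)

/-- The digit map `x ↦ (ξ_i(x))_i` is measurable. [folklore] -/
private theorem measurable_digits' : Measurable fun x : ℝ => Real.digits x b := by
  refine measurable_pi_lambda _ fun i => ?_
  exact (measurable_from_top (f := fun m : ℕ => (Fin.ofNat b m : Fin b))).comp
    (Nat.measurable_floor.comp (measurable_id.mul_const _))

/-- `wal_k` is a step function [cite: DickPillichshammer2010, Prop. A.2], hence measurable. -/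
@[fun_prop] theorem measurable_walsh (k : ℕ) : Measurable (walsh b k) :=
  (measurable_walshD k).comp measurable_digits'

/-- An additive character maps finite sums to products. [folklore] -/
private theorem map_sum_eq_prod {A M ι : Type*} [AddCommMonoid A] [CommMonoid M]
    (ψ : AddChar A M) (s : Finset ι) (f : ι → A) :
    ψ (∑ i ∈ s, f i) = ∏ i ∈ s, ψ (f i) := by
  classical
  induction s using Finset.induction_on with
  | empty => simp
  | insert a s ha ih => rw [sum_insert ha, prod_insert ha, AddChar.map_add_eq_mul, ih]

/-! ### Orthonormality (Propositions A.9, A.10) -/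

/-- Reindexing a sum over the digits `Fin b` as a sum over `ℤ_b`. [folklore] -/
private theorem sum_fin_eq_sum_zmod {M : Type*} [AddCommMonoid M] (F : ZMod b → M) :
    ∑ a : Fin b, F ((a : ℕ) : ZMod b) = ∑ x : ZMod b, F x := by
  refine Fintype.sum_bijective (fun a : Fin b => ((a : ℕ) : ZMod b)) ?_ _ _ fun _ => rfl
  refine (Fintype.bijective_iff_injective_and_card _).2 ⟨fun a₁ a₂ h => ?_, by simp⟩
  have h' : (a₁ : ℕ) % b = a₂ % b := (ZMod.natCast_eq_natCast_iff' _ _ _).1 h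
  exact Fin.ext (by rwa [Nat.mod_eq_of_lt a₁.2, Nat.mod_eq_of_lt a₂.2] at h')

/-- Character sum over one uniformly distributed digit:
`(1/b) Σ_{a ∈ ℤ_b} ω_b^{c a} = [c = 0]`. [folklore] -/
private theorem integral_stdAddChar_mul_digitMeasure (c : ZMod b) :
    ∫ a, ZMod.stdAddChar (c * ((a : ℕ) : ZMod b)) ∂digitMeasure b = if c = 0 then 1 else 0 := by
  classical
  rw [digitMeasure, integral_smul_measure, integral_count]
  simp_rw [mul_comm c]
  rw [sum_fin_eq_sum_zmod (fun x => ZMod.stdAddChar (x * c)),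
    AddChar.sum_mulShift c (ZMod.isPrimitive_stdAddChar b), ZMod.card,
    ENNReal.toReal_inv, ENNReal.toReal_natCast]
  have hb : (b : ℂ) ≠ 0 := Nat.cast_ne_zero.2 (NeZero.ne b)
  split_ifs <;> simp [hb]

/-- Product form of `wal_k · conj wal_l` over a digit range containing the digits of `k` and `l`:
`wal_k(ξ) conj(wal_l(ξ)) = ω_b^{Σ_{i<r} (κ_i - λ_i) ξ_{i+1}} = ∏_{i<r} ω_b^{(κ_i - λ_i) ξ_{i+1}}`
(`= wal_{k ⊖ l}(ξ)`). [cite: DickPillichshammer2010, Prop. A.4] (proof) -/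
theorem walshD_mul_conj_walshD_eq_prod {k l r : ℕ} (hk : ∀ i, r ≤ i → natDigit b k i = 0)
    (hl : ∀ i, r ≤ i → natDigit b l i = 0) (ξ : ℕ → Fin b) :
    walshD b k ξ * conj (walshD b l ξ) = ∏ i ∈ range r,
      ZMod.stdAddChar (((natDigit b k i : ZMod b) - (natDigit b l i : ZMod b)) *
        ((ξ i : ℕ) : ZMod b)) := by
  rw [conj_walshD, walshD, ← AddChar.map_add_eq_mul, walshPhase_eq_sum_of_natDigit_eq_zero hk,
    walshPhase_eq_sum_of_natDigit_eq_zero hl, ← sum_neg_distrib, ← sum_add_distrib,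
    map_sum_eq_prod]
  exact prod_congr rfl fun i _ => by congr 1; ring

/-- **Orthonormality of the Walsh system on the digit space**: for `b ≥ 2`,
`∫ wal_k conj(wal_l) dμ_b^ℕ = [k = l]`, where `μ_b^ℕ` is the uniform (product) measure on digit
sequences. [cite: DickPillichshammer2010, Prop. A.10] -/
theorem integral_walshD_mul_conj_walshD (hb : 1 < b) (k l : ℕ) :
    ∫ ξ, walshD b k ξ * conj (walshD b l ξ) ∂digitSeqMeasure b = if k = l then 1 else 0 := by
  classical
  set r := max k l with hr
  have hk : ∀ i, r ≤ i → natDigit b k i = 0 := fun i hi =>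
    natDigit_eq_zero_of_le b hb ((le_max_left k l).trans hi)
  have hl : ∀ i, r ≤ i → natDigit b l i = 0 := fun i hi =>
    natDigit_eq_zero_of_le b hb ((le_max_right k l).trans hi)
  set c : ℕ → ZMod b := fun i => (natDigit b k i : ZMod b) - (natDigit b l i : ZMod b) with hc
  set F : ↥(range r) → Fin b → ℂ := fun i a => ZMod.stdAddChar (c (i : ℕ) * ((a : ℕ) : ZMod b))
    with hF
  set G : (↥(range r) → Fin b) → ℂ := fun g => ∏ i : ↥(range r), F i (g i) with hG
  have hfun : (fun ξ : ℕ → Fin b => walshD b k ξ * conj (walshD b l ξ)) =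
      fun ξ => G (Finset.restrict (range r) ξ) := by
    ext ξ
    simp only [walshD_mul_conj_walshD_eq_prod hk hl, Finset.restrict_def, c, G, F]
    rw [← prod_coe_sort]
  rw [hfun, ← integral_map_of_stronglyMeasurable (Finset.measurable_restrict _)
    (measurable_of_countable G).stronglyMeasurable, digitSeqMeasure,
    Measure.infinitePi_map_restrict, hG, integral_fintype_prod_eq_prod F]
  simp only [hF]
  simp_rw [integral_stdAddChar_mul_digitMeasure]
  split_ifs with hkl
  · subst hkl
    exact prod_eq_one fun i _ => by simp [c]
  · -- some digit below `r` differs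
    have hkr : k < b ^ r := (le_max_left k l).trans_lt (Nat.lt_pow_self hb)
    have hlr : l < b ^ r := (le_max_right k l).trans_lt (Nat.lt_pow_self hb)
    obtain ⟨i, hi, hne⟩ : ∃ i < r, natDigit b k i ≠ natDigit b l i := by
      by_contra! H
      exact hkl (eq_of_natDigit_eq b hkr hlr H)
    refine prod_eq_zero (Finset.mem_univ ⟨i, mem_range.2 hi⟩) ?_
    rw [if_neg]
    exact fun h0 => hne (natDigit_injOn_zmod b (sub_eq_zero.1 h0))

/-- **Orthonormality of the `b`-adic Walsh system on `[0,1)`** (`s = 1`): for `b ≥ 2`,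
`∫₀¹ wal_k(x) conj(wal_l(x)) dx = 1` if `k = l` and `= 0` otherwise.
[cite: DickPillichshammer2010, Prop. A.10] -/
theorem setIntegral_walsh_mul_conj_walsh (hb : 1 < b) (k l : ℕ) :
    ∫ x in Ico (0 : ℝ) 1, walsh b k x * conj (walsh b l x) = if k = l then 1 else 0 := by
  have h := integral_walshD_mul_conj_walshD hb k l
  have hF : Measurable fun ξ : ℕ → Fin b => walshD b k ξ * conj (walshD b l ξ) :=
    (measurable_walshD k).mul (continuous_conj.measurable.comp (measurable_walshD l))
  rwa [← map_digits_restrict_Ico,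
    integral_map measurable_digits'.aemeasurable hF.aestronglyMeasurable] at h

/-- `∫₀¹ wal_k(x) dx = [k = 0]`. [cite: DickPillichshammer2010, Prop. A.9] -/
theorem setIntegral_walsh (hb : 1 < b) (k : ℕ) :
    ∫ x in Ico (0 : ℝ) 1, walsh b k x = if k = 0 then 1 else 0 := by
  simpa using setIntegral_walsh_mul_conj_walsh hb k 0

/-! ### Orthonormality on `[0,1)ˢ` -/

section Cube

variable {ι : Type*} [Fintype ι]

/-- Lebesgue measure on `[0,1)ˢ` is the product of Lebesgue measures on `[0,1)`. [folklore] -/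
private theorem volume_restrict_unitCubeIco' :
    (volume : Measure (ι → ℝ)).restrict (unitCubeIco ι) =
      Measure.pi fun _ : ι => (volume : Measure ℝ).restrict (Ico (0 : ℝ) 1) := by
  rw [unitCubeIco, volume_pi, Measure.restrict_pi_pi]

/-- `wal_k` is a step function on `[0,1)ˢ` [cite: DickPillichshammer2010, Prop. A.2] (with Def. A.3),
hence measurable. -/
@[fun_prop] theorem measurable_walshPi (k : ι → ℕ) : Measurable (walshPi b k) :=
  Finset.measurable_prod _ fun j _ => (measurable_walsh (k j)).comp (measurable_pi_apply j)

/-- **Orthonormality of the Walsh system in `L²([0,1)ˢ)`**: for `b ≥ 2` and `k, l ∈ ℕ₀ˢ`,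
`∫_{[0,1)ˢ} wal_k(x) conj(wal_l(x)) dx = 1` if `k = l` and `= 0` otherwise.
[cite: DickPillichshammer2010, Prop. A.10] -/
theorem setIntegral_walshPi_mul_conj_walshPi (hb : 1 < b) (k l : ι → ℕ) :
    ∫ x in unitCubeIco ι, walshPi b k x * conj (walshPi b l x) = if k = l then 1 else 0 := by
  classical
  have hprod : ∀ x : ι → ℝ, walshPi b k x * conj (walshPi b l x) =
      ∏ j, (walsh b (k j) (x j) * conj (walsh b (l j) (x j))) := by
    intro x
    rw [walshPi, walshPi, map_prod (starRingEnd ℂ), ← prod_mul_distrib]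
  simp_rw [hprod]
  rw [volume_restrict_unitCubeIco', integral_fintype_prod_eq_prod
    (fun j (t : ℝ) => walsh b (k j) t * conj (walsh b (l j) t))]
  simp_rw [setIntegral_walsh_mul_conj_walsh hb]
  split_ifs with h
  · subst h
    simp
  · obtain ⟨j, hj⟩ := Function.ne_iff.1 h
    exact prod_eq_zero (mem_univ j) (if_neg hj)

/-- `∫_{[0,1)ˢ} wal_k(x) dx = [k = 0]`. [cite: DickPillichshammer2010, Prop. A.9] -/
theorem setIntegral_walshPi (hb : 1 < b) (k : ι → ℕ) :
    ∫ x in unitCubeIco ι, walshPi b k x = if k = 0 then 1 else 0 := by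
  simpa using setIntegral_walshPi_mul_conj_walshPi hb k 0

variable (b) in
/-- The `k`-th **Walsh coefficient** `f̂(k) = ∫_{[0,1)ˢ} f(x) conj(wal_k(x)) dx` of `f`.
[cite: DickPillichshammer2010, Rem. A.15] (with Def. A.14, Walsh series `f = Σ_k f̂(k) wal_k`;
[cite: Lemieux2009, eq. (6.6)] writes `f̃(h)`). -/
def walshCoeff (f : (ι → ℝ) → ℂ) (k : ι → ℕ) : ℂ :=
  ∫ x in unitCubeIco ι, f x * conj (walshPi b k x)

/-- `f̂(0) = ∫_{[0,1)ˢ} f` since `wal_0 ≡ 1`. [cite: DickPillichshammer2010, Rem. A.15] -/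
@[simp] theorem walshCoeff_zero (f : (ι → ℝ) → ℂ) :
    walshCoeff b f 0 = ∫ x in unitCubeIco ι, f x := by
  simp [walshCoeff]

/-- The Walsh coefficients of a Walsh function: `(wal_l)^(k) = [k = l]`.
[cite: DickPillichshammer2010, Prop. A.10] -/
theorem walshCoeff_walshPi (hb : 1 < b) (k l : ι → ℕ) :
    walshCoeff b (walshPi b l) k = if k = l then 1 else 0 := by
  rw [walshCoeff, setIntegral_walshPi_mul_conj_walshPi hb l k]
  by_cases h : k = l
  · rw [if_pos h, if_pos h.symm]
  · rw [if_neg h, if_neg (Ne.symm h)]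

/-- Walsh functions are integrable on `[0,1)ˢ` against any integrable weight: here, the
summands `c_k wal_k conj(wal_l)` of a Walsh series. [folklore] -/
private theorem integrable_mul_walshPi_mul_conj (c : ℂ) (k l : ι → ℕ) :
    Integrable (fun x => c * walshPi b k x * conj (walshPi b l x))
      ((volume : Measure (ι → ℝ)).restrict (unitCubeIco ι)) := by
  refine (integrable_const ‖c‖).mono' ?_ (Filter.Eventually.of_forall fun x => ?_)
  · exact ((measurable_const.mul (measurable_walshPi k)).mul
      (continuous_conj.measurable.comp (measurable_walshPi l))).aestronglyMeasurable
  · simp [norm_walshPi]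

/-- **Walsh coefficients of an absolutely convergent Walsh series**: if `f = Σ_k c_k wal_k` with
`Σ_k |c_k| < ∞` then `f̂(l) = ∫ f conj(wal_l) = c_l` for every `l` (`b ≥ 2`).
[cite: DickPillichshammer2010, Rem. A.15] (term-by-term integration of the uniformly convergent
series against `conj(wal_l)`, using Prop. A.10). -/
theorem walshCoeff_tsum_mul_walshPi (hb : 1 < b) {c : (ι → ℕ) → ℂ}
    (hc : Summable fun k => ‖c k‖) (l : ι → ℕ) :
    walshCoeff b (fun x => ∑' k, c k * walshPi b k x) l = c l := by
  have hnorm : ∀ (k : ι → ℕ) (x : ι → ℝ), ‖c k * walshPi b k x * conj (walshPi b l x)‖ = ‖c k‖ := by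
    intro k x
    rw [norm_mul, norm_mul, RCLike.norm_conj, norm_walshPi, norm_walshPi, mul_one, mul_one]
  have hF_sum : Summable fun k =>
      ∫ x in unitCubeIco ι, ‖c k * walshPi b k x * conj (walshPi b l x)‖ := by
    refine hc.congr fun k => ?_
    simp_rw [hnorm]
    rw [integral_const, smul_eq_mul, probReal_univ, one_mul]
  have h1 : ∀ x : ι → ℝ, (∑' k, c k * walshPi b k x) * conj (walshPi b l x) =
      ∑' k, c k * walshPi b k x * conj (walshPi b l x) := fun x => tsum_mul_right.symm
  unfold walshCoeff
  simp_rw [h1]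
  rw [← integral_tsum_of_summable_integral_norm
    (fun k => integrable_mul_walshPi_mul_conj (c k) k l) hF_sum]
  simp_rw [mul_assoc, integral_const_mul, setIntegral_walshPi_mul_conj_walshPi hb, mul_ite,
    mul_one, mul_zero]
  exact tsum_ite_eq l c

end Cube

/-! ### Digital nets over `ℤ_b` -/

section DigitalNet

variable {ι : Type*} [Fintype ι] {m p : ℕ}

/-- The integer `y₁ b^{p-1} + y₂ b^{p-2} + ⋯ + y_p < b^p` encoded by a digit column
`y = (y₁, …, y_p)ᵀ ∈ ℤ_b^p` (most significant digit first), so that `x = (digitCode y) / b^p`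
is the point `y₁/b + ⋯ + y_p/b^p` of [cite: DickPillichshammer2010, Def. 4.47]. -/
def digitCode (y : Fin p → ZMod b) : Fin (b ^ p) :=
  finFunctionFinEquiv fun s : Fin p => (⟨(y (Fin.rev s)).val, ZMod.val_lt _⟩ : Fin b)

/-- The point `y₁/b + y₂/b² + ⋯ + y_p/b^p ∈ [0,1)` with the prescribed digit column
`y = (y₁, …, y_p)ᵀ ∈ ℤ_b^p` (realised as the rational `digitCode(y) / b^p`).
[cite: DickPillichshammer2010, Def. 4.47] -/
def pointOfDigits (y : Fin p → ZMod b) : ℝ :=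
  (digitCode y : ℕ) / (b : ℝ) ^ p

/-- The digit sequence `(y₁, …, y_p, 0, 0, …)` of a digit column `y ∈ ℤ_b^p` (the `b`-adic digits of
the point `y₁/b + ⋯ + y_p/b^p` of [cite: DickPillichshammer2010, Def. 4.47]). -/
def digitSeqOf (y : Fin p → ZMod b) : ℕ → Fin b :=
  fun i => if h : i < p then ⟨(y ⟨i, h⟩).val, ZMod.val_lt _⟩ else 0

/-- **Digital net over `ℤ_b`** (digital construction scheme): given generating matrices
`C₁, …, C_s ∈ ℤ_b^{p × m}`, the point attached to the digit vector `h⃗ = (h₀, …, h_{m-1})ᵀ ∈ ℤ_b^m`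
of `h = h₀ + h₁ b + ⋯ + h_{m-1} b^{m-1}` has `j`-th coordinate
`x_{h,j} = y_{j,1}/b + ⋯ + y_{j,p}/b^p` where `(y_{j,1}, …, y_{j,p})ᵀ = C_j h⃗`.
[cite: DickPillichshammer2010, Def. 4.47] (there `p = m` and `b` prime; rectangular `p × m`
matrices as in [cite: Lemieux2009, Def. 5.5] with finite precision; the construction makes sense
over the ring `ℤ_b` for every `b ≥ 2`). We index the `b^m` points directly by `h⃗ ∈ ℤ_b^m`. -/
def digitalNetPoint (C : ι → Matrix (Fin p) (Fin m) (ZMod b)) (h : Fin m → ZMod b) : ι → ℝ :=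
  fun j => pointOfDigits (C j *ᵥ h)

variable (b) in
/-- A digital net over `ℤ_b` with `m` columns has `b^m` points `x_0, …, x_{b^m - 1}` (here indexed by
`ℤ_b^m`). [cite: DickPillichshammer2010, Def. 4.47] -/
theorem card_index (m : ℕ) : Fintype.card (Fin m → ZMod b) = b ^ m := by
  simp [ZMod.card]

/-- `digitCode y = Σ_s y_{p-s} b^s`. [folklore] -/
private theorem digitCode_val (y : Fin p → ZMod b) :
    (digitCode y : ℕ) = ∑ s : Fin p, (y (Fin.rev s)).val * b ^ (s : ℕ) := by
  simp [digitCode]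

/-- `x = y₁/b + ⋯ + y_p/b^p`. [cite: DickPillichshammer2010, Def. 4.47] -/
theorem pointOfDigits_eq_sum (y : Fin p → ZMod b) :
    pointOfDigits y = ∑ r : Fin p, ((y r).val : ℝ) / (b : ℝ) ^ ((r : ℕ) + 1) := by
  have hb : (b : ℝ) ≠ 0 := Nat.cast_ne_zero.2 (NeZero.ne b)
  rw [pointOfDigits, digitCode_val, Nat.cast_sum, sum_div]
  refine Fintype.sum_equiv Fin.revPerm _ _ fun s => ?_
  rw [Fin.revPerm_apply, Nat.cast_mul, Nat.cast_pow, Fin.val_rev]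
  have hs : (s : ℕ) + (p - (s + 1) + 1) = p := by have := s.2; omega
  rw [div_eq_div_iff (pow_ne_zero _ hb) (pow_ne_zero _ hb), mul_assoc, ← pow_add, hs]

/-- The `b`-adic digits of the point `y₁/b + ⋯ + y_p/b^p` are `y₁, …, y_p, 0, 0, …`.
[cite: DickPillichshammer2010, Def. 4.47] (the defining `b`-adic expansion of the points `x_{h,j}`). -/
theorem digits_pointOfDigits (y : Fin p → ZMod b) :
    Real.digits (pointOfDigits y) b = digitSeqOf y := by
  have hb : (b : ℝ) ≠ 0 := Nat.cast_ne_zero.2 (NeZero.ne b)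
  ext i : 1
  change Fin.ofNat b ⌊pointOfDigits y * (b : ℝ) ^ (i + 1)⌋₊ = digitSeqOf y i
  unfold pointOfDigits digitSeqOf
  split_ifs with hi
  · -- digit `i < p`: `⌊A / b^q⌋ mod b` with `p = (i + 1) + q`
    obtain ⟨q, hq⟩ : ∃ q, p = i + 1 + q := ⟨p - (i + 1), by omega⟩
    have hx : ((digitCode y : ℕ) : ℝ) / (b : ℝ) ^ p * (b : ℝ) ^ (i + 1) =
        ((digitCode y : ℕ) : ℝ) / ((b ^ q : ℕ) : ℝ) := by
      have hp : (b : ℝ) ^ p = (b : ℝ) ^ (i + 1) * (b : ℝ) ^ q := by rw [← pow_add, ← hq]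
      rw [hp, Nat.cast_pow]
      field_simp
    rw [hx, Nat.floor_div_eq_div]
    have hg : ∀ s : Fin p, (digitCode y : ℕ) / b ^ (s : ℕ) % b = (y (Fin.rev s)).val := by
      intro s
      have h1 := finFunctionFinEquiv_symm_apply_val (finFunctionFinEquiv
        fun s : Fin p => (⟨(y (Fin.rev s)).val, ZMod.val_lt _⟩ : Fin b)) s
      rw [Equiv.symm_apply_apply] at h1
      exact h1.symm
    apply Fin.ext
    rw [Fin.val_ofNat, hg ⟨q, by omega⟩]
    exact congrArg (fun s => (y s).val) (Fin.ext (by simp only [Fin.val_rev]; omega))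
  · -- digit `i ≥ p`: `A b^{i+1-p}` is an integer divisible by `b`
    obtain ⟨q, hq⟩ : ∃ q, i + 1 = p + (q + 1) := ⟨i - p, by omega⟩
    have hx : ((digitCode y : ℕ) : ℝ) / (b : ℝ) ^ p * (b : ℝ) ^ (i + 1) =
        (((digitCode y : ℕ) * b ^ q * b : ℕ) : ℝ) := by
      rw [hq, pow_add, pow_succ]
      push_cast
      field_simp
    rw [hx, Nat.floor_natCast]
    apply Fin.ext
    rw [Fin.val_ofNat, Nat.mul_mod_left, Fin.val_zero]


/-- `0 ≤ y₁/b + ⋯ + y_p/b^p < 1`. [cite: DickPillichshammer2010, Def. 4.47] -/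
theorem pointOfDigits_mem_Ico (y : Fin p → ZMod b) : pointOfDigits y ∈ Ico (0 : ℝ) 1 := by
  have hb : (0 : ℝ) < (b : ℝ) ^ p := pow_pos (Nat.cast_pos.2 (Nat.pos_of_neZero b)) _
  refine ⟨div_nonneg (Nat.cast_nonneg _) hb.le, (div_lt_one hb).2 ?_⟩
  exact_mod_cast (digitCode y).2

omit [Fintype ι] in
/-- The points of a digital net lie in `[0,1)ˢ`. [cite: DickPillichshammer2010, Def. 4.47] -/
theorem digitalNetPoint_mem_unitCubeIco (C : ι → Matrix (Fin p) (Fin m) (ZMod b))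
    (h : Fin m → ZMod b) : digitalNetPoint C h ∈ unitCubeIco ι :=
  fun j _ => pointOfDigits_mem_Ico (C j *ᵥ h)

/-- `y₁/b + ⋯ + y_p/b^p = 0.y₁y₂…y_p 000…` as a `b`-adic expansion (`b ≥ 2`). [folklore] -/
private theorem ofDigits_digitSeqOf (hb : 1 < b) (y : Fin p → ZMod b) :
    Real.ofDigits (digitSeqOf y) = pointOfDigits y := by
  rw [← digits_pointOfDigits, Real.ofDigits_digits hb (pointOfDigits_mem_Ico y)]

/-- Digit-wise addition of digit columns is addition of their digit sequences. [folklore] -/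
private theorem digitSeqOf_add (y₁ y₂ : Fin p → ZMod b) :
    digitSeqOf (y₁ + y₂) = digitSeqOf y₁ + digitSeqOf y₂ := by
  ext i : 1
  simp only [digitSeqOf, Pi.add_apply]
  split_ifs with hi
  · exact Fin.ext (by simp only [Fin.val_add, ZMod.val_add])
  · simp

/-- **Group structure of digital nets**: the points of a digital net form a group under the
digital shift, isomorphic to `ℤ_b^m` — `x_{h₁} ⊕ x_{h₂} = x_{h₁ + h₂}` coordinatewise (`b ≥ 2`).
[cite: DickPillichshammer2010, Lemma 4.72] (with the `b`-adic digital shift of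
[cite: Lemieux2009, §6.2.2]). -/
theorem digitalShift_pointOfDigits (hb : 1 < b) (y₁ y₂ : Fin p → ZMod b) :
    digitalShift b (pointOfDigits y₁) (pointOfDigits y₂) = pointOfDigits (y₁ + y₂) := by
  rw [digitalShift, digits_pointOfDigits, digits_pointOfDigits, ← digitSeqOf_add,
    ofDigits_digitSeqOf hb]

omit [Fintype ι] in
/-- `x_{h₁} ⊕ x_{h₂} = x_{h₁ + h₂}` for the points of a digital net (`b ≥ 2`).
[cite: DickPillichshammer2010, Lemma 4.72] -/
theorem digitalShiftPi_digitalNetPoint (hb : 1 < b) (C : ι → Matrix (Fin p) (Fin m) (ZMod b))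
    (h₁ h₂ : Fin m → ZMod b) :
    digitalShiftPi b (digitalNetPoint C h₁) (digitalNetPoint C h₂) =
      digitalNetPoint C (h₁ + h₂) := by
  ext j
  simp only [digitalShiftPi, digitalNetPoint, mulVec_add]
  exact digitalShift_pointOfDigits hb _ _

variable (b) in
omit [NeZero b] in
/-- The column `tr_p(k⃗) = (κ₀, …, κ_{p-1})ᵀ ∈ ℤ_b^p` of the first `p` base-`b` digits of `k`.
[cite: DickPillichshammer2010, Lemma 4.75] -/
def digitVec (p k : ℕ) : Fin p → ZMod b := fun i => (natDigit b k i : ZMod b)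

variable (b) in
omit [NeZero b] in
/-- `tr_p(0⃗) = 0`. [folklore] -/
@[simp] private theorem digitVec_zero (p : ℕ) : digitVec b p 0 = 0 := by
  ext i; simp [digitVec, natDigit_zero]

/-- A Walsh function at a point with prescribed digit column: `wal_k(y₁/b + ⋯ + y_p/b^p)
= ω_b^{tr_p(k⃗) · y}`. [cite: DickPillichshammer2010, Lemma 4.75] (proof). -/
theorem walsh_pointOfDigits (k : ℕ) (y : Fin p → ZMod b) :
    walsh b k (pointOfDigits y) = ZMod.stdAddChar (digitVec b p k ⬝ᵥ y) := by
  rw [walsh, digits_pointOfDigits, walshD,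
    walshPhase_eq_sum_of_apply_eq_zero (N := p) fun i hi => by simp [digitSeqOf, not_lt.2 hi]]
  congr 1
  rw [dotProduct,
    Finset.sum_range fun i => (natDigit b k i : ZMod b) * ((digitSeqOf y i : ℕ) : ZMod b)]
  refine sum_congr rfl fun i _ => ?_
  simp [digitSeqOf, digitVec]

/-- The multivariate Walsh function at a digital-net point:
`wal_k(x_h) = ω_b^{(C₁ᵀ tr_p(k⃗₁) + ⋯ + C_sᵀ tr_p(k⃗_s)) · h⃗}`.
[cite: DickPillichshammer2010, Lemma 4.75] (proof). -/
theorem walshPi_digitalNetPoint (C : ι → Matrix (Fin p) (Fin m) (ZMod b)) (k : ι → ℕ)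
    (h : Fin m → ZMod b) :
    walshPi b k (digitalNetPoint C h) =
      ZMod.stdAddChar ((∑ j, (C j)ᵀ *ᵥ digitVec b p (k j)) ⬝ᵥ h) := by
  simp only [walshPi, digitalNetPoint, walsh_pointOfDigits]
  rw [← map_sum_eq_prod, sum_dotProduct]
  congr 1
  refine sum_congr rfl fun j _ => ?_
  rw [dotProduct_mulVec, mulVec_transpose]

/-- The **dual net** `D(C₁, …, C_s) = {k ∈ ℕ₀ˢ : C₁ᵀ tr_p(k⃗₁) + ⋯ + C_sᵀ tr_p(k⃗_s) = 0}`
(the form `D_∞` with all `k ∈ ℕ₀ˢ`, digits beyond the precision `p` being irrelevant).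
[cite: DickPillichshammer2010, Def. 4.76] (and Remark 4.77; [cite: Lemieux2009, eq. (5.27)] calls it
the dual space `C_s^*` of the net, with `∞ × k` generating matrices). -/
def dualNet (C : ι → Matrix (Fin p) (Fin m) (ZMod b)) : Set (ι → ℕ) :=
  {k | ∑ j, (C j)ᵀ *ᵥ digitVec b p (k j) = 0}

omit [NeZero b] in
/-- `k ∈ D ⟺ C₁ᵀ tr_p(k⃗₁) + ⋯ + C_sᵀ tr_p(k⃗_s) = 0`. [cite: DickPillichshammer2010, Def. 4.76] -/
theorem mem_dualNet {C : ι → Matrix (Fin p) (Fin m) (ZMod b)} {k : ι → ℕ} :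
    k ∈ dualNet C ↔ ∑ j, (C j)ᵀ *ᵥ digitVec b p (k j) = 0 := Iff.rfl

/-- Membership in the dual net is a finite linear condition over `ℤ_b`, hence decidable.
[folklore] -/
instance decidableMemDualNet (C : ι → Matrix (Fin p) (Fin m) (ZMod b)) (k : ι → ℕ) :
    Decidable (k ∈ dualNet C) :=
  inferInstanceAs (Decidable (∑ j, (C j)ᵀ *ᵥ digitVec b p (k j) = 0))

omit [NeZero b] in
/-- `0 ∈ D` (the error formulas sum over `D ∖ {0}`). [cite: Lemieux2009, eq. (6.6)]
[cite: DickPillichshammer2010, §15.1] -/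
@[simp] theorem zero_mem_dualNet (C : ι → Matrix (Fin p) (Fin m) (ZMod b)) :
    (0 : ι → ℕ) ∈ dualNet C := by
  simp [mem_dualNet]

/-- **Character property of digital nets**: for generating matrices `C₁, …, C_s ∈ ℤ_b^{p×m}`
with points `x_0, …, x_{b^m - 1}` and every `k ∈ ℕ₀ˢ`,
`Σ_h wal_k(x_h) = b^m` if `k ∈ D(C₁, …, C_s)` and `= 0` otherwise.
[cite: DickPillichshammer2010, Lemma 4.75] (with Remark 4.77 for `k` beyond `b^m`;
[cite: Lemieux2009, Lemma 5.18] is the case `k ∈ C_s^⊥`; both state it for prime `b`, the proof —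
a character sum over the finite abelian group `ℤ_b^m` — works for every `b ≥ 2`). -/
theorem sum_walshPi_digitalNetPoint (C : ι → Matrix (Fin p) (Fin m) (ZMod b)) (k : ι → ℕ) :
    ∑ h : Fin m → ZMod b, walshPi b k (digitalNetPoint C h) =
      if k ∈ dualNet C then (b : ℂ) ^ m else 0 := by
  classical
  set D := ∑ j, (C j)ᵀ *ᵥ digitVec b p (k j) with hD
  let ψ : AddChar (Fin m → ZMod b) ℂ :=
    { toFun := fun h => ZMod.stdAddChar (D ⬝ᵥ h)
      map_zero_eq_one' := by simp
      map_add_eq_mul' := fun x y => by simp [dotProduct_add, AddChar.map_add_eq_mul] }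
  have hψ : ∀ h, walshPi b k (digitalNetPoint C h) = ψ h := fun h =>
    walshPi_digitalNetPoint C k h
  simp_rw [hψ]
  rw [AddChar.sum_eq_ite]
  have hiff : ψ = 0 ↔ k ∈ dualNet C := by
    rw [mem_dualNet, ← hD, AddChar.eq_zero_iff]
    constructor
    · intro H
      ext i
      have Hi := H (Pi.single i 1)
      change ZMod.stdAddChar (D ⬝ᵥ Pi.single i 1) = 1 at Hi
      rw [dotProduct_single, mul_one,
        (ZMod.isPrimitive_stdAddChar b).zmod_char_eq_one_iff b] at Hi
      exact Hi
    · intro H x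
      change ZMod.stdAddChar (D ⬝ᵥ x) = 1
      rw [H, zero_dotProduct, AddChar.map_zero_eq_one]
  simp only [hiff, card_index]
  split_ifs <;> simp

/-- The **equal-weight (QMC) rule over a digital net**: `Q(f) = b^{-m} Σ_h f(x_h)`.
[cite: DickPillichshammer2010, §15.1] -/
def digitalNetRule (C : ι → Matrix (Fin p) (Fin m) (ZMod b)) {E : Type*} [AddCommMonoid E]
    [Module ℝ E] (f : (ι → ℝ) → E) : E :=
  ((b : ℝ) ^ m)⁻¹ • ∑ h : Fin m → ZMod b, f (digitalNetPoint C h)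

/-- A digital net integrates `wal_k` to `𝟙_D(k)`: `(1/n) Σ_i wal_k(u_i) = 1` if `k ∈ C_s^*` and
`0` otherwise. [cite: Lemieux2009, Lemma 5.18] [cite: DickPillichshammer2010, Lemma 4.75] -/
theorem digitalNetRule_walshPi (C : ι → Matrix (Fin p) (Fin m) (ZMod b)) (k : ι → ℕ) :
    digitalNetRule C (walshPi b k) = if k ∈ dualNet C then (1 : ℂ) else 0 := by
  have hb : (b : ℂ) ^ m ≠ 0 := pow_ne_zero _ (Nat.cast_ne_zero.2 (NeZero.ne b))
  rw [digitalNetRule, sum_walshPi_digitalNetPoint, Complex.real_smul]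
  split_ifs <;> simp [hb]

/-- **Aliasing / Walsh-series formula for digital nets**: if `f(x_h) = Σ_k f̃(k) wal_k(x_h)`
(a convergent Walsh series representation at the nodes, e.g. an absolutely convergent Walsh
series), then `Q(f) = b^{-m} Σ_h f(x_h) = Σ_{k ∈ D} f̃(k)`.
[cite: DickPillichshammer2010, §15.1] (the computation opening the section, via Lemma 4.75);
[cite: Lemieux2009, eq. (6.6)]. -/
theorem hasSum_digitalNetRule (C : ι → Matrix (Fin p) (Fin m) (ZMod b)) {f : (ι → ℝ) → ℂ}
    {c : (ι → ℕ) → ℂ}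
    (hf : ∀ h : Fin m → ZMod b,
      HasSum (fun k => c k * walshPi b k (digitalNetPoint C h)) (f (digitalNetPoint C h))) :
    HasSum (fun k => if k ∈ dualNet C then c k else 0) (digitalNetRule C f) := by
  have H := (hasSum_sum (s := Finset.univ) fun (h : Fin m → ZMod b) _ => hf h).const_smul
    (((b : ℝ) ^ m)⁻¹)
  have hb : (b : ℂ) ^ m ≠ 0 := pow_ne_zero _ (Nat.cast_ne_zero.2 (NeZero.ne b))
  rw [digitalNetRule]
  convert H using 1
  ext k
  rw [← mul_sum, sum_walshPi_digitalNetPoint, Complex.real_smul]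
  push_cast
  split_ifs
  · field_simp
  · simp

/-- Subtype form of `hasSum_digitalNetRule`: `Q(f) = Σ_{k ∈ D} f̃(k)`.
[cite: DickPillichshammer2010, §15.1] -/
theorem hasSum_digitalNetRule_subtype (C : ι → Matrix (Fin p) (Fin m) (ZMod b))
    {f : (ι → ℝ) → ℂ} {c : (ι → ℕ) → ℂ}
    (hf : ∀ h : Fin m → ZMod b,
      HasSum (fun k => c k * walshPi b k (digitalNetPoint C h)) (f (digitalNetPoint C h))) :
    HasSum (fun k : dualNet C => c k) (digitalNetRule C f) := by
  classical
  refine (hasSum_subtype_iff_indicator (f := c) (s := dualNet C)).mpr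
    ((hasSum_digitalNetRule C hf).congr_fun fun k => ?_)
  rw [Set.indicator_apply]

/-- **Integration error of a digital net as a sum over the dual net**: if
`f(x_h) = Σ_k f̃(k) wal_k(x_h)` at the nodes, then
`Q(f) - f̃(0) = Σ_{k ∈ D ∖ {0}} f̃(k)`; for the Walsh coefficients `f̃ = f̂` one has `f̂(0) = ∫ f`
(`walshCoeff_zero`), giving `b^{-m} Σ_h f(x_h) - ∫_{[0,1]ˢ} f = Σ_{k ∈ D_∞ ∖ {0}} f̂(k)`.
[cite: DickPillichshammer2010, §15.1] (first display of the section);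
[cite: Lemieux2009, eq. (6.6)] (`Q_n - I(f) = Σ_{0 ≠ h ∈ C_s^*} f̃(h)` under absolute convergence). -/
theorem hasSum_digitalNetRule_sub (C : ι → Matrix (Fin p) (Fin m) (ZMod b))
    {f : (ι → ℝ) → ℂ} {c : (ι → ℕ) → ℂ}
    (hf : ∀ h : Fin m → ZMod b,
      HasSum (fun k => c k * walshPi b k (digitalNetPoint C h)) (f (digitalNetPoint C h))) :
    HasSum (fun k : (dualNet C \ {0} : Set (ι → ℕ)) => c k) (digitalNetRule C f - c 0) := by
  classical
  have H0 : HasSum ((dualNet C).indicator c) (digitalNetRule C f) :=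
    hasSum_subtype_iff_indicator.mp (hasSum_digitalNetRule_subtype C hf)
  have H1 := hasSum_ite_sub_hasSum H0 0
  rw [Set.indicator_of_mem (zero_mem_dualNet C)] at H1
  refine (hasSum_subtype_iff_indicator (f := c)
    (s := (dualNet C \ {0} : Set (ι → ℕ)))).mpr (H1.congr_fun fun k => ?_)
  by_cases h0 : k = 0
  · subst h0; simp
  · simp only [h0, if_false, Set.indicator_apply, Set.mem_sdiff, Set.mem_singleton_iff,
      not_false_eq_true, and_true]

/-- The Walsh-coefficient form: if `f(x_h) = Σ_k f̂(k) wal_k(x_h)` at the nodes of the net (e.g.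
`f` has an absolutely convergent Walsh series representation), then
`b^{-m} Σ_h f(x_h) - ∫_{[0,1)ˢ} f = Σ_{k ∈ D ∖ {0}} f̂(k)`.
[cite: DickPillichshammer2010, §15.1] [cite: Lemieux2009, eq. (6.6)] -/
theorem hasSum_digitalNetRule_sub_integral (C : ι → Matrix (Fin p) (Fin m) (ZMod b))
    {f : (ι → ℝ) → ℂ} (hf : ∀ h : Fin m → ZMod b,
      HasSum (fun k => walshCoeff b f k * walshPi b k (digitalNetPoint C h))
        (f (digitalNetPoint C h))) :
    HasSum (fun k : (dualNet C \ {0} : Set (ι → ℕ)) => walshCoeff b f k)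
      (digitalNetRule C f - ∫ x in unitCubeIco ι, f x) := by
  simpa using hasSum_digitalNetRule_sub C hf

/-- `tsum` form of the error formula `Q(f) - ∫ f = Σ_{k ∈ D ∖ {0}} f̂(k)`.
[cite: Lemieux2009, eq. (6.6)] [cite: DickPillichshammer2010, §15.1] -/
theorem digitalNetRule_sub_integral_eq_tsum (C : ι → Matrix (Fin p) (Fin m) (ZMod b))
    {f : (ι → ℝ) → ℂ} (hf : ∀ h : Fin m → ZMod b,
      HasSum (fun k => walshCoeff b f k * walshPi b k (digitalNetPoint C h))
        (f (digitalNetPoint C h))) :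
    digitalNetRule C f - ∫ x in unitCubeIco ι, f x =
      ∑' k : (dualNet C \ {0} : Set (ι → ℕ)), walshCoeff b f k :=
  (hasSum_digitalNetRule_sub_integral C hf).tsum_eq.symm

/-- **Error bound**: `|Q(f) - ∫ f| ≤ Σ_{k ∈ D ∖ {0}} |f̂(k)|` for `f` with absolutely summable Walsh
coefficients represented by its Walsh series at the nodes.
[cite: Lemieux2009, eq. (6.6)] (and the absolute-convergence condition stated after it). -/
theorem norm_digitalNetRule_sub_integral_le (C : ι → Matrix (Fin p) (Fin m) (ZMod b))
    {f : (ι → ℝ) → ℂ} (hs : Summable (walshCoeff b f)) (hf : ∀ h : Fin m → ZMod b,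
      HasSum (fun k => walshCoeff b f k * walshPi b k (digitalNetPoint C h))
        (f (digitalNetPoint C h))) :
    ‖digitalNetRule C f - ∫ x in unitCubeIco ι, f x‖ ≤
      ∑' k : (dualNet C \ {0} : Set (ι → ℕ)), ‖walshCoeff b f k‖ := by
  rw [digitalNetRule_sub_integral_eq_tsum C hf]
  exact norm_tsum_le_tsum_norm (hs.norm.subtype _)

/-- **Digital nets applied to absolutely convergent Walsh series**: if `f = Σ_k c_k wal_k` on
`[0,1)ˢ` with `Σ_k |c_k| < ∞`, then `f̂ = c` and
`b^{-m} Σ_h f(x_h) - ∫_{[0,1)ˢ} f = Σ_{k ∈ D ∖ {0}} c_k` (`b ≥ 2`).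
[cite: DickPillichshammer2010, §15.1] -/
theorem hasSum_digitalNetRule_tsum_sub_integral (hb : 1 < b)
    (C : ι → Matrix (Fin p) (Fin m) (ZMod b)) {c : (ι → ℕ) → ℂ} (hc : Summable fun k => ‖c k‖) :
    HasSum (fun k : (dualNet C \ {0} : Set (ι → ℕ)) => c k)
      (digitalNetRule C (fun x => ∑' k, c k * walshPi b k x) -
        ∫ x in unitCubeIco ι, ∑' k, c k * walshPi b k x) := by
  have hrep : ∀ h : Fin m → ZMod b, HasSum
      (fun k => walshCoeff b (fun x => ∑' k, c k * walshPi b k x) k *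
        walshPi b k (digitalNetPoint C h)) (∑' k, c k * walshPi b k (digitalNetPoint C h)) := by
    intro h
    simp_rw [walshCoeff_tsum_mul_walshPi hb hc]
    refine (Summable.of_norm ?_).hasSum
    exact hc.congr fun k => by simp [norm_walshPi]
  have H := hasSum_digitalNetRule_sub_integral C hrep
  simp_rw [walshCoeff_tsum_mul_walshPi hb hc] at H
  exact H

end DigitalNet

end Literature.Analysis.Quadrature
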